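import Summits.QuantumFields.BalabanUV.Beta.GAN24.CombesThomasFibreStep
import Summits.QuantumFields.BalabanUV.Beta.GAN24.ConvCBridge

/-!
# `BalabanUV.Beta.GAN24.ConvCKOfShapes` — binder row G-an2-4 / (CONV-C), road P1-fibre, typer row P1-L12a (node N20f, END-AS-FUNCTION):
# the K-slot package `ConvCK d Lc` PROVED AS A FUNCTION OF THE TWO LOCATED SHAPES, in the LITERAL units `(sfStep Lc, smStep d Lc)`

NOT IN PRINT; OUR PROOF ATTEMPT.  HONEST FRAMING (cell contract, verbatim): «discharging `BetaPertH` makes Bałaban's UV stability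
UNCONDITIONAL — a real constructive-QFT result; it is NOT the continuum limit and NOT the Clay problem.»  HONEST DEPENDENCY (verbatim):
«continuum YM on T⁴ ⇐ BetaPertH ∧ nine spine estimates (0/9 proved); BetaPertH ⇐ (D1) ∧ (D4) ∧ CAP+tail; G-an2-4 gates asym, D1 and
NE2/3/4.»  [folklore] bookkeeping: composition of LANDED reductions, no estimate, no cited fact.  NOTHING of (CONV-C)'s K-slot is discharged
here: the two shapes below are HYPOTHESES (road P1 rows L10 = (I3′) and L11 = (I2′) are to conclude them); 0 wall binders instantiated; the
stencil (S) and second-order (W) binders and the identification stay binders (rows D1 / asym1).  NOT summit progress.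

## What is proved (generic `d`, blocking factor `Lc ≥ 1`; `D = d + 1`; `N = Lc^(j+1)`, `M = Lc^j`; units `sfStep Lc j = Lc^j`, `smStep d Lc j = Lc^{j(d+1)}`)
The two LOCATED SHAPES of `SKELETON-P1.md` (exactly the hypotheses of the landed fibre reductions `CombesThomasFibreStep.unitDecayK_of_stripRegular`
(S0d, p198220) and `CombesThomasFibreStep.supRateK_of_kFib` (S0c, p197800)), given names so that rows L10 / L11 conclude them BY NAME:
* `StripRegularK d Lc κ Cst` := `∀ j x′ y′ a b, StripRegular (kFibΔ Lc (sfStep Lc) (smStep d Lc) j a x′ b y′) κ Cst` — (I3′) the `j`-UNIFORM strip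
  regularity of the explicit offset-rebased fibre functions (a PREDICATE carrying its parameters = hypothesis `hA`; asserted nowhere);
* `RealRateK d Lc c θ` := `∀ j x′ y′ a b, ∀ p ∈ BZ (d+1), ‖kFib … (j+1) … (ofRealVec p) − kFib … j … (ofRealVec p)‖ ≤ c·θ^j` — (I2′) the
  `j`-GEOMETRIC real-zone rate (a PREDICATE = hypothesis `hB`; asserted nowhere).
Then (all `0 sorry`, compositions of landed declarations BY NAME):
* **`convCK_of_strip_rate`** `(hκ : 0 < κ) (hc : 0 ≤ c) (hθ0 : 0 ≤ θ) (hθ1 : θ < 1) (hA) (hB) : ConvCK d Lc` — witnesses `C = Cst·e^{2κ}`,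
  `δ = κ/((d+1)·Lc)` (from `unitDecayK_of_stripRegular`), `(c, θ)` (from `supRateK_of_kFib`); named-shape twin `convCK_of_shapes`;
* `convCKWall_of_strip_rate` / `convCKWall_of_shapes` : `ConvCKWall d Lc` (via `CombesThomas.convCKWall_of_convCK`);
* `d = 3`: `convCResolvent_of_strip_rate` — p3's target `PropagatorWoodburyFibreTarget.ConvCResolvent Lc C (δ/2) cK √θ` with the explicit constants
  (via `ConvCBridge.convCResolvent_of_unitDecayK_supRateK`), and **`d1Drift_JsBalOf_iff_of_strip_rate`** — the WALL PLUG: an2's END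
  `d1Drift_JsBalOf_iff_of_unitDecayK_supRateK_step` (GAN24/CombesThomas §4) with its `(hK, hKall)`-slots now FUNCTIONS OF `(hA, hB)`; the window
  condition reads `R < κ/(8·Lc)` (= `δ/2`, `δ = κ/(4Lc)`); every other binder (hS, hSall, hW, hWall, the identification) is untouched.
So road P1 is «DONE MODULO TWO SHAPES» in the kernel: `ConvCK d Lc ⇐ StripRegularK d Lc κ Cst ∧ RealRateK d Lc c θ ∧ 0 < κ ∧ 0 ≤ c ∧ 0 ≤ θ < 1`.
-/

noncomputable section

open Complex MeasureTheory Finset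
open scoped BigOperators
open Literature.MathematicalPhysics.QuantumFieldTheory
open Literature.MathematicalPhysics.QuantumFieldTheory.Balaban1983to89
open Literature.MathematicalPhysics.QuantumFieldTheory.Balaban1983to89.Beta
open B4Strip (ofRealVec)
open B4ContourShift (BZ StripRegular)
open ExpKernelCalculus (MKer Decays VertexFamily₂ hessKer)
open OneStepResolventKernel (Fib LocStencil)
open OneStepKernelFamily (KInvStep D1Drift)
open AxialDressing (axDressK axVertexOfK)
open BalabanStepJetsSucc (JsBal0Of JsBalOf)
open HessKerDressedLimit (limMKerOf limStOf limTabOf)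
open Summit.QuantumFields.BalabanUV.Beta.HessKerDressedUnits (unitK unitS unitW)
open Summit.QuantumFields.BalabanUV.Beta.GAN24.CombesThomas (UnitDecayK SupRateK CauchyDecayK sfStep smStep KStepUnit ConvCK ConvCKWall
  convCKWall_of_convCK d1Drift_JsBalOf_iff_of_unitDecayK_supRateK_step)
open Summit.QuantumFields.BalabanUV.Beta.GAN24.CombesThomasFibreStep (kFib kFibΔ supRateK_of_kFib unitDecayK_of_stripRegular)
open Summit.QuantumFields.BalabanUV.Beta.PropagatorWoodburyFibreTarget (ConvCResolvent)
open Summit.QuantumFields.BalabanUV.Beta.GAN24.ConvCBridge (convCResolvent_of_unitDecayK_supRateK)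

namespace Summit.QuantumFields.BalabanUV.Beta.GAN24.ConvCKOfShapes

variable {d : ℕ} {Lc : ℕ} [NeZero Lc]

/-! ## §1 The two located shapes, named (predicates carrying their parameters; asserted nowhere) -/

/-- **(I3′) — SHAPE A**: `j`-UNIFORM STRIP REGULARITY of the explicit offset-rebased fibre functions `kFibΔ_j` in the LITERAL units
`(Lc^j, Lc^{j(d+1)})`, with ONE `κ` and ONE `Cst` for all `j, x′, y′, a, b` — exactly the hypothesis of
`CombesThomasFibreStep.unitDecayK_of_stripRegular`.  A predicate (road P1 row L10 is to conclude it); never a fact. -/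
def StripRegularK (d Lc : ℕ) [NeZero Lc] (κ Cst : ℝ) : Prop :=
  ∀ (j : ℕ) (x' y' : Fin (d + 1) → ℤ) (a b : Fib d), StripRegular (kFibΔ Lc (sfStep Lc) (smStep d Lc) j a x' b y') κ Cst

/-- **(I2′) — SHAPE B**: `j`-GEOMETRIC REAL-ZONE RATE `‖kFib_{j+1}(p) − kFib_j(p)‖ ≤ c·θ^j` on the Brillouin zone, in the LITERAL units —
exactly the hypothesis of `CombesThomasFibreStep.supRateK_of_kFib`.  A predicate (road P1 row L11 is to conclude it); never a fact. -/
def RealRateK (d Lc : ℕ) [NeZero Lc] (c θ : ℝ) : Prop :=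
  ∀ (j : ℕ) (x' y' : Fin (d + 1) → ℤ) (a b : Fib d), ∀ p ∈ BZ (d + 1),
    ‖kFib Lc (sfStep Lc) (smStep d Lc) (j + 1) a x' b y' (ofRealVec p) - kFib Lc (sfStep Lc) (smStep d Lc) j a x' b y' (ofRealVec p)‖
      ≤ c * θ ^ j

/-- [folklore] SHAPE A ⇒ the wall's uniform-decay binder `UnitDecayK` in the literal units, constants `(Cst·e^{2κ}, κ/((d+1)·Lc))`
(`unitDecayK_of_stripRegular` BY NAME). -/
theorem unitDecayK_of_stripRegularK {κ Cst : ℝ} (hκ : 0 ≤ κ) (hA : StripRegularK d Lc κ Cst) :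
    UnitDecayK d Lc (sfStep Lc) (smStep d Lc) (Cst * Real.exp (2 * κ)) (κ / ((d + 1) * Lc)) :=
  unitDecayK_of_stripRegular (sfStep Lc) (smStep d Lc) hκ hA

/-- [folklore] SHAPE B ⇒ the one-step sup-norm rate `SupRateK` in the literal units, same `(c, θ)` (`supRateK_of_kFib` BY NAME). -/
theorem supRateK_of_realRateK {c θ : ℝ} (hc : 0 ≤ c) (hθ : 0 ≤ θ) (hB : RealRateK d Lc c θ) :
    SupRateK d Lc (sfStep Lc) (smStep d Lc) c θ :=
  supRateK_of_kFib (sfStep Lc) (smStep d Lc) hc hθ hB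

/-- [folklore] The decay rate delivered by SHAPE A is positive when `κ > 0`: `0 < κ/((d+1)·Lc)`. -/
theorem decayRate_pos {κ : ℝ} (hκ : 0 < κ) : 0 < κ / ((d + 1 : ℝ) * Lc) := by
  have hLc : (0 : ℝ) < Lc := by exact_mod_cast Nat.pos_of_ne_zero (NeZero.ne Lc)
  positivity

/-! ## §2 The END node as a function of the two shapes -/

/-- **ROAD P1 END-AS-FUNCTION (typer row P1-L12a)**: in the LITERAL units `(sfStep Lc, smStep d Lc)`, a `j`-uniform strip bound for the
`kFibΔ_j` (κ > 0) and a `j`-geometric real-zone rate for `kFib_{j+1} − kFib_j` (`0 ≤ θ < 1`) give the K-slot package `ConvCK d Lc`, with witnesses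
`C = Cst·e^{2κ}`, `δ = κ/((d+1)·Lc)`, `c`, `θ`.  The two hypotheses are the located shapes (I3′)/(I2′); nothing is instantiated. -/
theorem convCK_of_strip_rate {κ Cst c θ : ℝ} (hκ : 0 < κ) (hc : 0 ≤ c) (hθ0 : 0 ≤ θ) (hθ1 : θ < 1)
    (hA : ∀ (j : ℕ) (x' y' : Fin (d + 1) → ℤ) (a b : Fib d), StripRegular (kFibΔ Lc (sfStep Lc) (smStep d Lc) j a x' b y') κ Cst)
    (hB : ∀ (j : ℕ) (x' y' : Fin (d + 1) → ℤ) (a b : Fib d), ∀ p ∈ BZ (d + 1),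
      ‖kFib Lc (sfStep Lc) (smStep d Lc) (j + 1) a x' b y' (ofRealVec p) - kFib Lc (sfStep Lc) (smStep d Lc) j a x' b y' (ofRealVec p)‖
        ≤ c * θ ^ j) :
    ConvCK d Lc :=
  ⟨Cst * Real.exp (2 * κ), κ / ((d + 1) * Lc), c, θ, decayRate_pos hκ, hθ0, hθ1,
    unitDecayK_of_stripRegular (sfStep Lc) (smStep d Lc) hκ.le hA, supRateK_of_kFib (sfStep Lc) (smStep d Lc) hc hθ0 hB⟩

/-- [folklore] The same with the named shapes: `StripRegularK ∧ RealRateK ⇒ ConvCK`. -/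
theorem convCK_of_shapes {κ Cst c θ : ℝ} (hκ : 0 < κ) (hc : 0 ≤ c) (hθ0 : 0 ≤ θ) (hθ1 : θ < 1)
    (hA : StripRegularK d Lc κ Cst) (hB : RealRateK d Lc c θ) : ConvCK d Lc :=
  convCK_of_strip_rate hκ hc hθ0 hθ1 hA hB

/-- [folklore] **WALL FORM**: the two shapes give the wall's package `ConvCKWall d Lc` (`convCKWall_of_convCK` BY NAME: rate `√θ`, decay `δ/2`). -/
theorem convCKWall_of_strip_rate {κ Cst c θ : ℝ} (hκ : 0 < κ) (hc : 0 ≤ c) (hθ0 : 0 ≤ θ) (hθ1 : θ < 1)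
    (hA : ∀ (j : ℕ) (x' y' : Fin (d + 1) → ℤ) (a b : Fib d), StripRegular (kFibΔ Lc (sfStep Lc) (smStep d Lc) j a x' b y') κ Cst)
    (hB : ∀ (j : ℕ) (x' y' : Fin (d + 1) → ℤ) (a b : Fib d), ∀ p ∈ BZ (d + 1),
      ‖kFib Lc (sfStep Lc) (smStep d Lc) (j + 1) a x' b y' (ofRealVec p) - kFib Lc (sfStep Lc) (smStep d Lc) j a x' b y' (ofRealVec p)‖
        ≤ c * θ ^ j) :
    ConvCKWall d Lc :=
  convCKWall_of_convCK (convCK_of_strip_rate hκ hc hθ0 hθ1 hA hB)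

/-- [folklore] Named-shape twin of `convCKWall_of_strip_rate`. -/
theorem convCKWall_of_shapes {κ Cst c θ : ℝ} (hκ : 0 < κ) (hc : 0 ≤ c) (hθ0 : 0 ≤ θ) (hθ1 : θ < 1)
    (hA : StripRegularK d Lc κ Cst) (hB : RealRateK d Lc c θ) : ConvCKWall d Lc :=
  convCKWall_of_convCK (convCK_of_shapes hκ hc hθ0 hθ1 hA hB)

/-! ## §3 Dimension four: p3's target and the wall plug, as functions of the two shapes -/

section DimFour

variable {Lc : ℕ} [NeZero Lc]

/-- [folklore] **p3's TARGET from the two shapes** (`d = 3`): `ConvCResolvent Lc C (δ/2) cK √θ` with the explicit constants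
`C = Cst·e^{2κ}`, `δ = κ/(4·Lc)`, `cK = √(2(c/(1−θ))·C)` (`ConvCBridge.convCResolvent_of_unitDecayK_supRateK` BY NAME). -/
theorem convCResolvent_of_strip_rate {κ Cst c θ : ℝ} (hκ : 0 < κ) (hc : 0 ≤ c) (hθ0 : 0 ≤ θ) (hθ1 : θ < 1)
    (hA : StripRegularK 3 Lc κ Cst) (hB : RealRateK 3 Lc c θ) :
    ConvCResolvent Lc (Cst * Real.exp (2 * κ)) (κ / ((3 + 1) * Lc) / 2)
      (Real.sqrt (2 * (c / (1 - θ)) * (Cst * Real.exp (2 * κ)))) (Real.sqrt θ) :=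
  convCResolvent_of_unitDecayK_supRateK (unitDecayK_of_stripRegularK (d := 3) hκ.le hA) (supRateK_of_realRateK (d := 3) hc hθ0 hB)
    (decayRate_pos (d := 3) hκ).le hθ0 hθ1

variable (hLc : 1 ≤ Lc) (cE cVH cΛ : ℝ)
  (W : ℕ → Fin (3 + 1) → (Fin (3 + 1) → ℤ) → Fin (3 + 1) → (Fin (3 + 1) → ℤ) → MKer (3 + 1) (Fib 3))
  (Cw' δw : ℕ → ℝ) (hδw : ∀ j, 0 < δw j) (hW' : ∀ j, VertexFamily₂ (W j) Lc (Cw' j) (δw j))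
  {R Cs cS δS Cw cW δW : ℝ}

/-- [folklore] **THE WALL PLUG AS A FUNCTION OF THE TWO SHAPES** (`d = 3`, adopted units `(Lc^j, Lc^{4j})`): an2's END
`d1Drift_JsBalOf_iff_of_unitDecayK_supRateK_step` (GAN24/CombesThomas §4) with its propagator slots `(hK, hKall)` fed by SHAPE A (strip
regularity, `κ > 0`) and SHAPE B (real-zone rate, `0 ≤ θ < 1`); the locality window is `R < κ/(8·Lc)` (`= δ/2`, `δ = κ/(4Lc)`).  The stencil
binders `hS, hSall`, the second-order binders `hW, hWall` and the identification remain hypotheses (rows D1 / asym1); NOTHING is instantiated. -/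
theorem d1Drift_JsBalOf_iff_of_strip_rate {κ Cst c θ : ℝ} (hκ : 0 < κ) (hc : 0 ≤ c)
    (hA : StripRegularK 3 Lc κ Cst) (hB : RealRateK 3 Lc c θ)
    (hS : ∀ j, LocStencil (unitS (sfStep Lc j) (smStep 3 Lc j) (JsBal0Of hLc cE cVH cΛ W Cw' δw hδw hW' j).S) Cs δS)
    (hSall : ∀ k j, LocStencil (unitS (sfStep Lc (k + j)) (smStep 3 Lc (k + j)) (JsBal0Of hLc cE cVH cΛ W Cw' δw hδw hW' (k + j)).S -
      unitS (sfStep Lc k) (smStep 3 Lc k) (JsBal0Of hLc cE cVH cΛ W Cw' δw hδw hW' k).S) (cS * Real.sqrt θ ^ k) δS)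
    (hW : ∀ j, VertexFamily₂ (unitW (sfStep Lc j) (smStep 3 Lc j) (W j)) Lc Cw δW)
    (hWall : ∀ k j, VertexFamily₂ (unitW (sfStep Lc (k + j)) (smStep 3 Lc (k + j)) (W (k + j)) -
      unitW (sfStep Lc k) (smStep 3 Lc k) (W k)) Lc (cW * Real.sqrt θ ^ k) δW)
    (hR : 0 < R) (hRK : R < κ / (8 * Lc)) (hRS : R / 2 < δS) (hRW : R < δW) (hθ0 : 0 ≤ θ) (hθ1 : θ < 1) (μ ν : Fin 4) (N : ℝ) :
    D1Drift Lc (JsBalOf hLc cE cVH cΛ W Cw' δw hδw hW') N μ ν ↔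
      B12Beta.secondMoment (hessKer (axDressK Lc (limMKerOf fun j => KStepUnit (d := 3) Lc j))
        (axVertexOfK (limMKerOf fun j => KStepUnit (d := 3) Lc j) Lc
          (limStOf fun j => unitS (sfStep Lc j) (smStep 3 Lc j) (JsBal0Of hLc cE cVH cΛ W Cw' δw hδw hW' j).S))
        (limTabOf fun j => unitW (sfStep Lc j) (smStep 3 Lc j) (W j))) μ ν = B12Normalization.stepBal N Lc := by
  have hRK' : R < κ / ((3 + 1 : ℝ) * Lc) / 2 := by
    have e : κ / ((3 + 1 : ℝ) * Lc) / 2 = κ / (8 * Lc) := by ring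
    rw [e]; exact hRK
  exact d1Drift_JsBalOf_iff_of_unitDecayK_supRateK_step hLc cE cVH cΛ W Cw' δw hδw hW'
    (unitDecayK_of_stripRegularK (d := 3) hκ.le hA) (supRateK_of_realRateK (d := 3) hc hθ0 hB)
    hS hSall hW hWall hR hRK' hRS hRW hθ0 hθ1 μ ν N

end DimFour

end Summit.QuantumFields.BalabanUV.Beta.GAN24.ConvCKOfShapes

end
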